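import Summits.AtomisticToContinuum.HydrodynamicLimit.Theses.TwoClocks
import Literature.MathematicalPhysics.KineticTheory.HardSphereEulerLLN

/-!
# Sketch — crux-ideate stmt-AtomisticToContinuum-16625 (`TwoClocks.TransferEntropyClock`), round 1, ideator 1

First lemmas of the two idea cards `equilibrium-hull-finite-consultation` and
`integrated-clock-density-sweep` (planner-cruxidea-stmt-AtomisticToContinuum-16625-1-0, 2026-08-16).
Statements only (Props); nothing here is asserted as true.  They must elaborate.

* `TiltHullLemma`      — pure convex analysis (Mathlib-provable now): a convex function on `ℝⁿ` that is `≤ ε` at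
                          `0` and at the `2n` points `± r_i e_i` is `≤ ε` on the cross-polytope `Σ |ξ_i|/r_i ≤ 1`.
                          This is the engine of FINITE CONSULTATION: pointwise-in-the-functional thresholds of an
                          exponential-moment bound become a threshold uniform on a ball of any finite-dimensional
                          span of functionals, consulting the black box at `2n` instances.
* `DiniConvex`         — pointwise ↓-convergence of convex functions to `0` on a neighbourhood of a compact convex
                          set is uniform on the set (uniform `τ₀`).
* `windowLogMGF`       — the per-particle window log-mgf of a one-body functional under a local Gibbs law (the
                          quantity every kinetic LD input of the route bounds).
* `EquilibriumWindowMonotone` — at GLOBAL equilibrium (constant profiles, flow-invariant law) the window log-mgf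
                          is non-increasing along integer multiples of the window (Hölder + invariance): `∃ τ`
                          inputs serve every longer window.
* `LocalAdditivityKinetic` — THE load-bearing dynamical lemma (LA, upper bound, sup form): at FIXED `β, τ`, as
                          `N → ∞`, the window log-mgf under a dilute LOCAL Gibbs law is bounded by the worst
                          HOMOGENEOUS (global-equilibrium) log-mgf density over the local parameter values
                          `(ρ₀(x)σ³, u₀(x), θ₀(x), F(x,·))`, realised as the instance `σ_x = σ ρ₀(x)^{1/3}`,
                          window `τ ρ₀(x)^{1/3}` (zoom to unit density), functional `v ↦ F(x,v)`.
-/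

noncomputable section

open MeasureTheory Filter Set Finset Topology
open scoped ENNReal

namespace Summit.AtomisticToContinuum.HydrodynamicLimit.Cruxes.TransferEntropyClock.IdeatorOne

open Literature.MathematicalPhysics.KineticTheory Literature.Analysis.FluidPDE

/-! ## §1 Convex-analysis engine (finite consultation) -/

/-- **Tilt-hull lemma.** For a convex `f : (Fin n → ℝ) → ℝ` with `f 0 ≤ ε` and `f (± r_i e_i) ≤ ε` for positive radii
`r_i`, every `ξ` in the cross-polytope `Σ_i |ξ_i| / r_i ≤ 1` has `f ξ ≤ ε` (it is a convex combination of those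
`2n+1` points).  Mathlib: `ConvexOn.le_sup_of_mem_convexHull`-type / Jensen for finite convex combinations. -/
def TiltHullLemma : Prop :=
  ∀ (n : ℕ) (f : (Fin n → ℝ) → ℝ) (ε : ℝ) (r : Fin n → ℝ), ConvexOn ℝ Set.univ f → (∀ i, 0 < r i) →
    f 0 ≤ ε → (∀ i, f (Pi.single i (r i)) ≤ ε) → (∀ i, f (Pi.single i (-(r i))) ≤ ε) →
    ∀ ξ : Fin n → ℝ, ∑ i, |ξ i| / r i ≤ 1 → f ξ ≤ ε


/-- **The tilt-hull lemma holds** (kernel-checked here; Jensen for the `2n+1`-point convex combination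
`ξ = Σ_i (|ξ_i|/r_i)·(sgn ξ_i · r_i e_i) + (1 − Σ_i |ξ_i|/r_i)·0`). -/
theorem tiltHullLemma_holds : TiltHullLemma := by
  intro n f ε r hf hr h0 hp hm ξ hξ
  classical
  -- weights and points indexed by `Option (Fin n)`: `none ↦ (1 - Σ|ξ_i|/r_i, 0)`, `some i ↦ (|ξ_i|/r_i, ± r_i e_i)`
  let w : Option (Fin n) → ℝ := fun o => o.elim (1 - ∑ i, |ξ i| / r i) (fun i => |ξ i| / r i)
  let p : Option (Fin n) → (Fin n → ℝ) := fun o =>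
    o.elim 0 (fun i => if 0 ≤ ξ i then Pi.single i (r i) else Pi.single i (-(r i)))
  have hw0 : ∀ o ∈ (univ : Finset (Option (Fin n))), 0 ≤ w o := by
    intro o _
    cases o with
    | none => simp only [w, Option.elim]; linarith
    | some i => simp only [w, Option.elim]; exact div_nonneg (abs_nonneg _) (hr i).le
  have hw1 : ∑ o ∈ (univ : Finset (Option (Fin n))), w o = 1 := by
    rw [Fintype.sum_option]
    simp only [w, Option.elim]
    ring
  have hmem : ∀ o ∈ (univ : Finset (Option (Fin n))), p o ∈ (Set.univ : Set (Fin n → ℝ)) :=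
    fun _ _ => Set.mem_univ _
  have hJ := hf.map_sum_le hw0 hw1 hmem
  -- the barycentre is `ξ`
  have hbary : ∑ o ∈ (univ : Finset (Option (Fin n))), w o • p o = ξ := by
    rw [Fintype.sum_option]
    simp only [w, p, Option.elim, smul_zero, zero_add]
    ext k
    rw [Finset.sum_apply]
    have : ∀ i : Fin n, ((|ξ i| / r i) • (if 0 ≤ ξ i then Pi.single i (r i) else Pi.single i (-(r i))
        : Fin n → ℝ)) k = if i = k then ξ k else 0 := by
      intro i
      by_cases hik : i = k
      · subst hik
        rw [if_pos rfl]
        have hri : r i ≠ 0 := (hr i).ne'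
        by_cases h : 0 ≤ ξ i
        · rw [if_pos h]
          simp only [Pi.smul_apply, Pi.single_eq_same, smul_eq_mul, abs_of_nonneg h]
          field_simp
        · rw [if_neg h]
          have h' : ξ i < 0 := lt_of_not_ge h
          simp only [Pi.smul_apply, Pi.single_eq_same, smul_eq_mul, abs_of_neg h']
          field_simp
      · rw [if_neg hik]
        split_ifs with h <;> simp [Ne.symm hik]
    simp_rw [this]
    simp
  rw [hbary] at hJ
  -- each vertex value is `≤ ε`
  have hval : ∀ o ∈ (univ : Finset (Option (Fin n))), w o • f (p o) ≤ w o • ε := by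
    intro o ho
    apply mul_le_mul_of_nonneg_left _ (hw0 o ho)
    cases o with
    | none => simpa [p] using h0
    | some i =>
      simp only [p, Option.elim]
      split_ifs
      · exact hp i
      · exact hm i
  calc f ξ ≤ ∑ o, w o • f (p o) := hJ
    _ ≤ ∑ o, w o • ε := Finset.sum_le_sum hval
    _ = ε := by rw [← Finset.sum_smul, hw1, one_smul]


/-- **Dini for convex functions.** A sequence of convex functions on `ℝⁿ`, pointwise non-increasing in `k` and
converging pointwise to `0` on an open ball of radius `2R`, converges uniformly on the closed ball of radius `R`
(Rockafellar, Convex Analysis, Thm 10.8).  Gives ONE window threshold `τ₀` for a whole ball of functionals. -/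
def DiniConvex : Prop :=
  ∀ (n : ℕ) (g : ℕ → (Fin n → ℝ) → ℝ) (R : ℝ), 0 < R → (∀ k, ConvexOn ℝ Set.univ (g k)) →
    (∀ k ξ, g (k + 1) ξ ≤ g k ξ) → (∀ ξ, ‖ξ‖ < 2 * R → Tendsto (fun k => g k ξ) atTop (nhds 0)) →
    ∀ ε : ℝ, 0 < ε → ∃ k₀ : ℕ, ∀ k, k₀ ≤ k → ∀ ξ, ‖ξ‖ ≤ R → g k ξ ≤ ε

/-! ## §2 The window log-mgf and its equilibrium monotonicity -/

/-- Per-particle window log-mgf `(N+1)⁻¹ log ∫ exp(β Σ_i w⁻¹∫₀ʷ F(z_i(r)) dr) dλ^N`, `w = τ (N+1)^{-1/3}`, under the local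
Gibbs law with profiles `(a, u₀, θ₀)` (the integrand of `KineticWindowLDUniform`; junk `log 0`/`toReal ∞` values are
irrelevant at the sketch level). -/
def windowLogMGF (σ : ℝ) (a θ₀ : T3 → ℝ) (u₀ : T3 → V3)
    (Φ : (N : ℕ) → HardSphereFlow (Torus.geometry (Fin 3)) (hsDiameter σ N) (N + 1))
    (F : T3 × V3 → ℝ) (β τ : ℝ) (N : ℕ) : ℝ :=
  ((N : ℝ) + 1)⁻¹ * Real.log (∫⁻ z, ENNReal.ofReal (Real.exp (β * ∑ i : Fin (N + 1),
      (τ * ((N : ℝ) + 1) ^ (-(1 / 3 : ℝ)))⁻¹ *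
        ∫ r in (0 : ℝ)..(τ * ((N : ℝ) + 1) ^ (-(1 / 3 : ℝ))), F ((Φ N).flow r z i)))
      ∂(localGibbsLaw σ a u₀ θ₀ N (Φ N))).toReal

/-- **Equilibrium window monotonicity** (exact at finite `N`): under the flow-INVARIANT canonical Gibbs law (constant
profiles) the window average over `kτ` is the mean of `k` consecutive window averages over `τ`, each with the law of
the first (invariance), so by Hölder `Λ_N(β; kτ) ≤ Λ_N(β; τ)`.  Consequence: an `∃ τ` input at equilibrium serves every
window `k τ`, `k ≥ 1`, with NO loss in the tilt. -/
def EquilibriumWindowMonotone : Prop :=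
  ∀ (σ a₀ θ₀ : ℝ) (u₀ : V3), 0 < σ → 0 < a₀ → 0 < θ₀ →
    ∀ (Φ : (N : ℕ) → HardSphereFlow (Torus.geometry (Fin 3)) (hsDiameter σ N) (N + 1))
      (F : T3 × V3 → ℝ), Continuous F → (∃ C : ℝ, ∀ y, |F y| ≤ C * (1 + ‖y.2‖ ^ 2)) →
    ∀ (β τ : ℝ), 0 < τ → ∀ (k N : ℕ), 1 ≤ k →
      windowLogMGF σ (fun _ => a₀) (fun _ => θ₀) (fun _ => u₀) Φ F β (k * τ) N ≤
        windowLogMGF σ (fun _ => a₀) (fun _ => θ₀) (fun _ => u₀) Φ F β τ N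

/-! ## §3 The load-bearing dynamical lemma: local additivity of window log-mgfs (upper bound) -/

/-- **Local additivity, kinetic, sup form (LA).**  `∃ η₀ > 0` such that for every `σ > 0`, all continuous positive
dilute profiles (`σ³·sup a ≤ η₀ ∫ a`), every flow family `Φ` of the inhomogeneous system, every family of comparison
flows `Φh x` of the HOMOGENEOUS systems at the local reduced densities (`σ_x = σ ρ₀(x)^{1/3}`, `ρ₀ = rhoLim`), every
continuous quadratic-growth `F` and every FIXED tilt `β` and window `τ`:
`limsup_N Λ_N^{local}(β; τ, F) ≤ sup_x limsup_N Λ_N^{hom,x}(β; τ ρ₀(x)^{1/3}, F(x,·))`.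
No `τ → ∞` inside: an `N → ∞` statement at fixed kinetic time.  Its RHS is what the equilibrium hull controls
uniformly; its truth is the bet (bias-priced, not influence-priced, dynamical locality across mesoscopic cells). -/
def LocalAdditivityKinetic : Prop :=
  ∃ η₀ : ℝ, 0 < η₀ ∧ ∀ σ : ℝ, 0 < σ → σ < 1 / 2 →
    ∀ (a θ₀ : T3 → ℝ) (u₀ : T3 → V3) (ha : Continuous a) (ha0 : ∀ x, 0 < a x),
      Continuous θ₀ → Continuous u₀ → (∀ x, 0 < θ₀ x) → σ ^ 3 * (⨆ x, a x) ≤ η₀ * ∫ x, a x →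
    ∀ (Φ : (N : ℕ) → HardSphereFlow (Torus.geometry (Fin 3)) (hsDiameter σ N) (N + 1))
      (Φh : (x : T3) → (N : ℕ) → HardSphereFlow (Torus.geometry (Fin 3))
        (hsDiameter (σ * rhoLim (profileOf a ha ha0) σ x ^ (1 / 3 : ℝ)) N) (N + 1))
      (F : T3 × V3 → ℝ), Continuous F → (∃ C : ℝ, ∀ y, |F y| ≤ C * (1 + ‖y.2‖ ^ 2)) →
    ∀ (β τ : ℝ), 0 < τ →
      limsup (fun N => windowLogMGF σ a θ₀ u₀ Φ F β τ N) atTop ≤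
        ⨆ x : T3, limsup (fun N => windowLogMGF (σ * rhoLim (profileOf a ha ha0) σ x ^ (1 / 3 : ℝ))
          (fun _ => (1 : ℝ)) (fun _ => θ₀ x) (fun _ => u₀ x) (Φh x) (fun y => F (x, y.2)) β
          (τ * rhoLim (profileOf a ha ha0) σ x ^ (1 / 3 : ℝ)) N) atTop


/-! ## §5 Card `integrated-clock-density-sweep`: first lemmas -/

/-- **Local additivity, kinetic, LOWER bound in integral form (LA⁻).**  The converse direction needed to EXTRACT
homogeneous information from ONE inhomogeneous instance: the local window log-mgf is at least the `ρ₀`-weighted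
spatial average of the homogeneous log-mgf densities (liminf version).  With `LocalAdditivityKinetic` this makes the
local log-mgf asymptotically the spatial integral of a local density, the hard-sphere-window analogue of
Kipnis–Landim Ch. 6 Prop. 1.6 / the formula `∫ du sup_λ {γ₀ F M − J_{ρ(s,u)}(λ)}`. -/
def LocalAdditivityKineticLower : Prop :=
  ∃ η₀ : ℝ, 0 < η₀ ∧ ∀ σ : ℝ, 0 < σ → σ < 1 / 2 →
    ∀ (a θ₀ : T3 → ℝ) (u₀ : T3 → V3) (ha : Continuous a) (ha0 : ∀ x, 0 < a x),
      Continuous θ₀ → Continuous u₀ → (∀ x, 0 < θ₀ x) → σ ^ 3 * (⨆ x, a x) ≤ η₀ * ∫ x, a x →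
    ∀ (Φ : (N : ℕ) → HardSphereFlow (Torus.geometry (Fin 3)) (hsDiameter σ N) (N + 1))
      (Φh : (x : T3) → (N : ℕ) → HardSphereFlow (Torus.geometry (Fin 3))
        (hsDiameter (σ * rhoLim (profileOf a ha ha0) σ x ^ (1 / 3 : ℝ)) N) (N + 1))
      (F : T3 × V3 → ℝ), Continuous F → (∃ C : ℝ, ∀ y, |F y| ≤ C * (1 + ‖y.2‖ ^ 2)) →
    ∀ (β τ : ℝ), 0 < τ →
      ∫ x, rhoLim (profileOf a ha ha0) σ x *
          liminf (fun N => windowLogMGF (σ * rhoLim (profileOf a ha ha0) σ x ^ (1 / 3 : ℝ))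
            (fun _ => (1 : ℝ)) (fun _ => θ₀ x) (fun _ => u₀ x) (Φh x) (fun y => F (x, y.2)) β
            (τ * rhoLim (profileOf a ha ha0) σ x ^ (1 / 3 : ℝ)) N) atTop
        ≤ liminf (fun N => windowLogMGF σ a θ₀ u₀ Φ F β τ N) atTop

/-- **Fubini beats pointwise (the extraction step, pure measure theory).**  A family `Λ k η ∈ [0, C]` on a band
`[η₁, η₂]`, measurable and non-increasing in `k`, whose LEBESGUE means over the band tend to `0`, tends to `0` in
`ν`-mean for every finite measure `ν ≪ Lebesgue` on the band (a.e. convergence from `L¹` + monotonicity, then dominated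
convergence).  In the clock: `Λ k` = homogeneous window log-mgf density at window `k τ₁`, the Lebesgue-mean bound comes
from ONE instance of `KineticWindowLDUniform` at a density-SWEEPING profile through `LA` + `LA⁻`, and `ν` is the
density-value distribution of the (generic) Euler reference on `[0,t] × 𝕋³`. -/
def InMeanExtraction : Prop :=
  ∀ (Λ : ℕ → ℝ → ℝ) (C η₁ η₂ : ℝ), η₁ < η₂ → (∀ k, Measurable (Λ k)) →
    (∀ k η, η ∈ Set.Icc η₁ η₂ → 0 ≤ Λ k η ∧ Λ k η ≤ C) → (∀ k η, Λ (k + 1) η ≤ Λ k η) →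
    Tendsto (fun k => ∫ η in Set.Icc η₁ η₂, Λ k η) atTop (nhds 0) →
    ∀ ν : Measure ℝ, IsFiniteMeasure ν → ν ≪ (volume.restrict (Set.Icc η₁ η₂)) →
      Tendsto (fun k => ∫ η, Λ k η ∂ν) atTop (nhds 0)


/-- **`InMeanExtraction` holds** (kernel-checked: antitone pointwise limit, monotone-convergence of integrals,
`∫ g = 0 ⇒ g = 0` a.e., transfer along `ν ≪ Leb|band`, dominated convergence with the constant bound). -/
theorem inMeanExtraction_holds : InMeanExtraction := by
  intro Λ C η₁ η₂ hη hmeas hbd hanti hL1 ν hfin hν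
  set μ : Measure ℝ := volume.restrict (Set.Icc η₁ η₂) with hμ
  haveI : IsFiniteMeasure μ := by
    rw [hμ]; exact isFiniteMeasure_restrict.mpr (by simp [Real.volume_Icc])
  -- a.e. on μ we are inside the band
  have hband : ∀ᵐ η ∂μ, η ∈ Set.Icc η₁ η₂ := by
    rw [hμ]; exact ae_restrict_mem measurableSet_Icc
  -- antitone in k, pointwise
  have hanti' : ∀ η, Antitone (fun k => Λ k η) := fun η => antitone_nat_of_succ_le (fun k => hanti k η)
  -- pointwise limit g η := ⨅ k, Λ k η on the band
  have hlim : ∀ η, η ∈ Set.Icc η₁ η₂ → Tendsto (fun k => Λ k η) atTop (𝓝 (⨅ k, Λ k η)) := by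
    intro η hηm
    apply tendsto_atTop_ciInf (hanti' η)
    exact ⟨0, by rintro _ ⟨k, rfl⟩; exact (hbd k η hηm).1⟩
  set g : ℝ → ℝ := fun η => ⨅ k, Λ k η with hg
  have hg_nonneg : ∀ η, η ∈ Set.Icc η₁ η₂ → 0 ≤ g η :=
    fun η hηm => le_ciInf (fun k => (hbd k η hηm).1)
  have hg_le : ∀ η, η ∈ Set.Icc η₁ η₂ → ∀ k, g η ≤ Λ k η := by
    intro η hηm k
    exact ciInf_le ⟨0, by rintro _ ⟨j, rfl⟩; exact (hbd j η hηm).1⟩ k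
  -- integrability on μ of each Λ k (bounded by C on a finite measure)
  have hint : ∀ k, Integrable (Λ k) μ := by
    intro k
    refine Integrable.of_bound (C := C) (hmeas k).aestronglyMeasurable ?_
    filter_upwards [hband] with η hηm
    rw [Real.norm_eq_abs, abs_of_nonneg (hbd k η hηm).1]
    exact (hbd k η hηm).2
  -- measurability / integrability of g
  have hg_meas : AEStronglyMeasurable g μ :=
    aestronglyMeasurable_of_tendsto_ae atTop (fun k => (hmeas k).aestronglyMeasurable)
      (by filter_upwards [hband] with η hηm; exact hlim η hηm)
  have hg_integrable : Integrable g μ := by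
    refine Integrable.of_bound (C := C) hg_meas ?_
    filter_upwards [hband] with η hηm
    rw [Real.norm_eq_abs, abs_of_nonneg (hg_nonneg η hηm)]
    exact (hg_le η hηm 0).trans (hbd 0 η hηm).2
  -- ∫ g dμ = lim ∫ Λ k dμ = 0
  have hconv : Tendsto (fun k => ∫ η, Λ k η ∂μ) atTop (𝓝 (∫ η, g η ∂μ)) := by
    apply integral_tendsto_of_tendsto_of_antitone hint hg_integrable
    · filter_upwards [hband] with η hηm
      exact fun i j hij => hanti' η hij
    · filter_upwards [hband] with η hηm
      exact hlim η hηm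
  have hg_int0 : ∫ η, g η ∂μ = 0 := tendsto_nhds_unique hconv hL1
  have hg_ae0 : g =ᵐ[μ] 0 := by
    have h0 : 0 ≤ᵐ[μ] g := by
      filter_upwards [hband] with η hηm; exact hg_nonneg η hηm
    exact (integral_eq_zero_iff_of_nonneg_ae h0 hg_integrable).mp hg_int0
  -- transfer to ν and conclude by dominated convergence with bound C
  have hband_ν : ∀ᵐ η ∂ν, η ∈ Set.Icc η₁ η₂ := hν hband
  have hlim_ν : ∀ᵐ η ∂ν, Tendsto (fun k => Λ k η) atTop (𝓝 0) := by
    filter_upwards [hν hg_ae0, hband_ν] with η hη0 hηm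
    have := hlim η hηm
    simp only [Pi.zero_apply] at hη0
    rwa [show (⨅ k, Λ k η) = 0 from hη0] at this
  have hdom := tendsto_integral_of_dominated_convergence (μ := ν) (fun _ => C)
    (fun k => (hmeas k).aestronglyMeasurable) (integrable_const C)
    (fun k => by
      filter_upwards [hband_ν] with η hηm
      rw [Real.norm_eq_abs, abs_of_nonneg (hbd k η hηm).1]
      exact (hbd k η hηm).2)
    hlim_ν
  simpa using hdom


/-! ## §4 How the pieces compose (documentation only)

`TransferEntropyClock` as typed ⟸ (proved heart `OneWindowLedger` of the sibling lines, fed by family-uniform nodes)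
⟸ family-uniform nodes DERIVED, not re-typed:
  * tilt/functional directions: `TiltHullLemma` + `DiniConvex` (+ a simplex argument for `N₀`) — finite consultation;
  * `(u₀, θ₀, a₀)` at global equilibrium: exact boost / velocity-scaling / canonical-activity symmetries of the
    hard-sphere flow (for the collisional input: after a per-cell covariant RE-CLAMPING priced by `TransferActivityTails`,
    because the lab-frame transfer activity `‖Δv‖ + |Δ‖v‖²|/2` is neither boost- nor scaling-covariant);
  * windows: `EquilibriumWindowMonotone`;
  * spatial profile / local vs global: `LocalAdditivityKinetic` (+ its collisional twin);
  * what stays pointwise: the DENSITY value `η = ρσ³` of global-equilibrium-typed inputs — see card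
    `integrated-clock-density-sweep` for the in-mean replacement of uniformity in `η`.
-/

end Summit.AtomisticToContinuum.HydrodynamicLimit.Cruxes.TransferEntropyClock.IdeatorOne

end
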